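import Summits.BirchSwinnertonDyer.BirchSwinnertonDyer.Theorems.ResidualThetaTransportAtTwoThetaLayerLambdaCongruenceAtTwoDepletionExact
import Summits.BirchSwinnertonDyer.BirchSwinnertonDyer.Theorems.ResidualThetaTransportAtTwoThetaLayerLambdaCongruenceAtTwoDepletionMonotone
import Summits.BirchSwinnertonDyer.BirchSwinnertonDyer.Theorems.ResidualThetaTransportAtTwoThetaLayerLambdaCongruenceAtTwoRelReduction
import HarnessLib

/-!
# Crux `ThetaLayerLambdaCongruenceAtTwo` (stmt-BirchSwinnertonDyer-20688, route ResidualThetaTransportAtTwo), line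
# `birth`: the stubs (H♮)/(μ♮) of skeleton v4 in the currency of DEPLETED PLUS-SYMBOL VALUES — equivalences, the
# minimal-`S₀` form, and the crux BY NAME from the two symbol-level stubs of skeleton v5 (lead prover bsd-wall-rtt-p3
# g2; `--supports stmt-BirchSwinnertonDyer-20688 --as helper`; closes nothing)

HONEST FRAMING. THEOREMS ONLY; the research inputs are explicit hypotheses spelled inline (they are the stubs of
skeleton v5 of line `birth`); nothing about any curve or form is asserted; BSD is not proved by any of this.

WHAT. The landed exact depletion identities (`…DepletionExact`, width seat w2: both depleted layer elements of the crux
are `C 2 · ∑_s C(φ^{S₀}(γ^s/2^{n+2}))·(X+1)^s` with the DEPLETED plus symbols `φ^{S₀}_W`, `φ^{S₀}_{g,Ω}`) and the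
group-ring isometry `‖∑ c_s (X+1)^s‖_sup = max_s ‖c_s‖` (`…SupNormIsometry`, width seat w3) turn the two research stubs
of skeleton v4 into statements about VALUES of depleted plus symbols at the layer-`n` cusps `γ^s/2^{n+2}`:
* §1 (algebra over any ultrametric normed field): `C a·(C b·Λ(c)) − C b·Λ(c') = C b·Λ(a c − c')`; `‖Λ(d)‖_sup < B ⟺
  ∀ s, ‖d_s‖ < B`; under `‖d_s‖ ≤ B` for all `s`, `‖Λ(d)‖_sup = B ⟺ ∃ s, ‖d_s‖ = B`.
* §2 (one layer, fixed data): `‖C a·Θ^{S₀}_n(W) − Θ^{S₀}_n(g;Ω)‖_sup < ‖2‖₂ ⟺ ∀ s, ‖a·φ^{S₀}_W(γ^s/2^{n+2}) −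
  φ^{S₀}_{g,Ω}(γ^s/2^{n+2})‖ < 1` (`supNorm_congr_lt_norm_two_iff_symbol`); the partner's depleted symbol values are
  integral at a cohomological period (`norm_depletedPartnerSymbol_le_one`), hence `‖Θ^{S₀}_n(g;Ω)‖_sup = ‖2‖₂ ⟺ ∃ s,
  ‖φ^{S₀}_{g,Ω}(γ^s/2^{n+2})‖ = 1` (`supNorm_eq_norm_two_iff_symbol`).
* §3 (package level): (H♮) `stub_depletedLayerCongruenceTwo` ⟺ (H-sym) «for large even `n`, `∃ a`, ALL layer-`n`
  depleted values are congruent: `‖a·φ^{S₀}_W − φ^{S₀}_{g,Ω}‖ < 1`» and (μ♮) `stub_depletedLayerMuTwo` ⟺ (μ-sym) «for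
  large even `n` SOME layer-`n` value `φ^{S₀}_{g,Ω}(γ^s/2^{n+2})` is a `2`-adic unit»; with w2's `S₀`-monotonicity
  (`stub_depletedLayerCongruenceTwo_of_minimal`) the congruence is only needed on the MINIMAL admissible `S₀`
  (all places bad for `W` or dividing `M`) — stub (H-sym-min); and THE CRUX BY NAME from (H-sym-min) + (μ-sym)
  (`thetaLayerLambdaCongruenceAtTwo_of_symbolStubs`) — the composition of skeleton v5 of line `birth`.
(H-sym-min) is Greenberg–Vatsal (10) / Vatsal (1.10) / Emerton–Pollack–Weston Thm. 1 READ AT `p = 2` in its own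
currency — congruence of the cohomologically normalised `Σ₀`-depleted plus modular symbols of the congruent pair
(`f_W`, `g`) up to a `2`-adic scalar — i.e. exactly what mod-`2` multiplicity one for `ρ̄ = W[2]` on the plus part plus
Ihara at `2` would deliver; (μ-sym) is `μ = 0` for the partner's depleted symbol at the `2`-power cusps (conjecture-grade).

References: [GreenbergVatsal2000] §1 (8)–(10), Prop. (2.4); [Vatsal1999] Thm. (1.10); [EmertonPollackWeston2006] Thm. 1;
[PollackWeston2011MT] §2.1–2.2, Def. 2.1, §3.1.
-/

noncomputable section

-- justification: the `Summit.BirchSwinnertonDyer.BirchSwinnertonDyer.…` path repeats a component (route-file convention)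
set_option linter.dupNamespace false

open scoped Classical

open Polynomial

open Literature.NumberTheory.IwasawaTheory Literature.NumberTheory.EllipticCurves
  Literature.NumberTheory.EllipticCurves.ModularForms

namespace Summit.BirchSwinnertonDyer.BirchSwinnertonDyer.Theorems.ThetaLayerLambdaCongruenceAtTwo

/-! ## §1. Layer sums: linear algebra and the isometry, in the forms needed -/

section LayerSums

variable {K : Type*} [NormedField K] [IsUltrametricDist K] {m : ℕ} [NeZero m]

omit [IsUltrametricDist K] in
/-- `C a·(C b·Λ(c)) − C b·Λ(c') = C b·Λ(s ↦ a·c_s − c'_s)` for layer sums `Λ(c) = ∑_s C(c_s)(X+1)^s`. [folklore] -/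
theorem C_mul_C_mul_layerSum_sub (a b : K) (c c' : ZMod m → K) :
    C a * (C b * ∑ t : ZMod m, C (c t) * (X + 1) ^ t.val) - C b * ∑ t : ZMod m, C (c' t) * (X + 1) ^ t.val =
      C b * ∑ t : ZMod m, C (a * c t - c' t) * (X + 1) ^ t.val := by
  rw [Finset.mul_sum, Finset.mul_sum, Finset.mul_sum, Finset.mul_sum, ← Finset.sum_sub_distrib]
  refine Finset.sum_congr rfl fun t _ ↦ ?_
  rw [map_sub, map_mul]
  ring

/-- `‖Λ(d)‖_sup < B ⟺ ∀ s, ‖d_s‖ < B` (the sup norm of a layer sum is the maximum of the `‖d_s‖`).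
[cite: PollackWeston2011MT, §3.1] -/
theorem supNorm_layerSum_lt_iff (d : ZMod m → K) (B : ℝ) :
    (∑ t : ZMod m, C (d t) * (X + 1) ^ t.val).supNorm < B ↔ ∀ t, ‖d t‖ < B := by
  constructor
  · exact fun h t ↦ (norm_le_supNorm_sum_C_mul_X_add_one_pow d t).trans_lt h
  · intro h
    obtain ⟨s, hs⟩ := exists_supNorm_sum_C_mul_X_add_one_pow_eq d
    rw [hs]
    exact h s

/-- Under `‖d_s‖ ≤ B` for all `s`: `‖Λ(d)‖_sup = B ⟺ ∃ s, ‖d_s‖ = B`. [cite: PollackWeston2011MT, §3.1] -/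
theorem supNorm_layerSum_eq_iff_of_forall_le (d : ZMod m → K) {B : ℝ} (hd : ∀ t, ‖d t‖ ≤ B) :
    (∑ t : ZMod m, C (d t) * (X + 1) ^ t.val).supNorm = B ↔ ∃ t, ‖d t‖ = B := by
  obtain ⟨s, hs⟩ := exists_supNorm_sum_C_mul_X_add_one_pow_eq d
  constructor
  · intro h
    exact ⟨s, hs ▸ h⟩
  · rintro ⟨t, ht⟩
    refine le_antisymm ((supNorm_sum_C_mul_X_add_one_pow_le_iff d ((norm_nonneg _).trans (hd t))).mpr hd) ?_
    rw [← ht]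
    exact norm_le_supNorm_sum_C_mul_X_add_one_pow d t

end LayerSums

/-! ## §2. One layer, fixed data: the stubs' conclusions in symbol currency -/

section OneLayer

/-- `‖2‖₂ > 0` in `ℚ̄₂`. [folklore] -/
theorem norm_two_padicAlgCl_pos : (0 : ℝ) < ‖(2 : PadicAlgCl 2)‖ := norm_pos_iff.mpr two_ne_zero

/-- **(H♮) at one layer ⟺ congruence of ALL layer-`n` depleted symbol values.** For the crux's data at layer `n` and a
scalar `a`: `‖C a·Θ^{S₀}_n(W) − Θ^{S₀}_n(g;Ω)‖_sup < ‖2‖₂` iff `‖a·φ^{S₀}_W(γ^s/2^{n+2}) − φ^{S₀}_{g,Ω}(γ^s/2^{n+2})‖ < 1`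
for every `s mod 2ⁿ` (exact depletion identities + `C a·C 2·Λ − C 2·Λ' = C 2·Λ(a·c − c')` + the isometry).
[cite: GreenbergVatsal2000, §1 (8)–(10)] -/
theorem supNorm_congr_lt_norm_two_iff_symbol (W : WeierstrassCurve ℚ) [NeZero (W.conductorNorm ℤ)]
    (f : CuspForm (CongruenceSubgroup.Gamma0 (W.conductorNorm ℤ)) 2) {M : ℕ} [NeZero M]
    (g : CuspForm (CongruenceSubgroup.Gamma0 M) 2) (ι : coeffField g →+* PadicAlgCl 2) (Ω : ℂ)
    (S₀ : Finset (IsDedekindDomain.HeightOneSpectrum (NumberField.RingOfIntegers ℚ)))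
    (hS2 : ∀ v ∈ S₀, ((2 : ℕ) : NumberField.RingOfIntegers ℚ) ∉ v.asIdeal) (n : ℕ) (a : PadicAlgCl 2) :
    (Polynomial.C a * (((Literature.NumberTheory.EllipticCurves.mazurTateElement f 2 n).map (algebraMap ℚ (PadicAlgCl 2)) * ∏ v ∈ S₀, ((W.localPolynomialAt v).map (Int.castRingHom (PadicAlgCl 2))).comp (Polynomial.C ((Rat.HeightOneSpectrum.natGenerator v : PadicAlgCl 2)⁻¹) * (Polynomial.X + 1) ^ (PadicInt.toZModPow n (-(Literature.NumberTheory.EllipticCurves.GreenbergVatsal2000.frobeniusExponent 2 (Rat.HeightOneSpectrum.natGenerator v : ℤ_[2])))).val)) %ₘ ((Polynomial.X + 1) ^ 2 ^ n - 1)) - (((Literature.NumberTheory.EllipticCurves.mazurTateElementK g Ω 2 n).map ι * ∏ v ∈ S₀, (1 - Polynomial.C (Literature.NumberTheory.EllipticCurves.embCoeff g ι (Rat.HeightOneSpectrum.natGenerator v)) * Polynomial.X + (if Rat.HeightOneSpectrum.natGenerator v ∣ M then 0 else Polynomial.C (Rat.HeightOneSpectrum.natGenerator v : PadicAlgCl 2))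 * Polynomial.X ^ 2).comp (Polynomial.C ((Rat.HeightOneSpectrum.natGenerator v : PadicAlgCl 2)⁻¹) * (Polynomial.X + 1) ^ (PadicInt.toZModPow n (-(Literature.NumberTheory.EllipticCurves.GreenbergVatsal2000.frobeniusExponent 2 (Rat.HeightOneSpectrum.natGenerator v : ℤ_[2])))).val)) %ₘ ((Polynomial.X + 1) ^ 2 ^ n - 1))).supNorm < ‖(2 : PadicAlgCl 2)‖ ↔
      ∀ s : ZMod (2 ^ n), ‖a * (∑ k ∈ Fintype.piFinset (fun _ : S₀ ↦ Finset.range 3), (∏ v : S₀, ((W.localPolynomialAt (v : IsDedekindDomain.HeightOneSpectrum (NumberField.RingOfIntegers ℚ))).map (Int.castRingHom (PadicAlgCl 2))).coeff (k v) * ((Rat.HeightOneSpectrum.natGenerator (v : IsDedekindDomain.HeightOneSpectrum (NumberField.RingOfIntegers ℚ)) : PadicAlgCl 2)⁻¹) ^ (k v)) * algebraMap ℚ (PadicAlgCl 2) (Literature.NumberTheory.EllipticCurves.ratPlusSymbol f (((((Literature.NumberTheory.EllipticCurves.cyclotomicGenerator 2 : ZMod (2 ^ (n + 2))) ^ s.val).val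 : ℚ) / (2 : ℚ) ^ (n + 2)) * ((∏ v : S₀, Rat.HeightOneSpectrum.natGenerator (v : IsDedekindDomain.HeightOneSpectrum (NumberField.RingOfIntegers ℚ)) ^ (k v) : ℕ) : ℚ)))) - (∑ k ∈ Fintype.piFinset (fun _ : S₀ ↦ Finset.range 3), (∏ v : S₀, (1 - Polynomial.C (Literature.NumberTheory.EllipticCurves.embCoeff g ι (Rat.HeightOneSpectrum.natGenerator (v : IsDedekindDomain.HeightOneSpectrum (NumberField.RingOfIntegers ℚ)))) * Polynomial.X + (if Rat.HeightOneSpectrum.natGenerator (v : IsDedekindDomain.HeightOneSpectrum (NumberField.RingOfIntegers ℚ)) ∣ M then 0 else Polynomial.C (Rat.HeightOneSpectrum.natGenerator (v : IsDedekindDomain.HeightOneSpectrum (NumberField.RingOfIntegers ℚ)) : PadicAlgCl 2)) * Polynomial.X ^ 2 : Polynomial (PadicAlgCl 2)).coeff (k v) * ((Rat.HeightOneSpectrum.natGenerator (v : IsDedekindDomain.HeightOneSpectrum (NumberField.RingOfIntegers ℚ)) : PadicAlgCl 2)⁻¹) ^ (k v)) * ι (Literature.NumberTheory.EllipticCurves.plusSymbolK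 g Ω (((((Literature.NumberTheory.EllipticCurves.cyclotomicGenerator 2 : ZMod (2 ^ (n + 2))) ^ s.val).val : ℚ) / (2 : ℚ) ^ (n + 2)) * ((∏ v : S₀, Rat.HeightOneSpectrum.natGenerator (v : IsDedekindDomain.HeightOneSpectrum (NumberField.RingOfIntegers ℚ)) ^ (k v) : ℕ) : ℚ))))‖ < 1 := by
  haveI : NeZero (2 ^ n) := ⟨pow_ne_zero _ two_ne_zero⟩
  rw [depletedCurveLayer_eq_layerSum_depletedSymbol f W n S₀ hS2,
    depletedPartnerLayer_eq_layerSum_depletedSymbol g Ω ι n M S₀ hS2, C_mul_C_mul_layerSum_sub, supNorm_C_mul,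
    mul_lt_iff_lt_one_right norm_two_padicAlgCl_pos, supNorm_layerSum_lt_iff]

/-- The coefficients of the partner's Euler polynomial `1 − ι a_ℓ(g)·X + 𝟙_{ℓ∤M} ℓ·X²` are `ι`-integral.
[cite: Shimura1971, Thm. 3.48(3)] -/
theorem norm_coeff_partnerEulerPolynomial_le_one {M : ℕ} [NeZero M] {g : CuspForm (CongruenceSubgroup.Gamma0 M) 2}
    (hg : IsNewform0 g) (ι : coeffField g →+* PadicAlgCl 2) (ℓ j : ℕ) :
    ‖(1 - C (embCoeff g ι ℓ) * X + (if ℓ ∣ M then 0 else C (ℓ : PadicAlgCl 2)) * X ^ 2 : (PadicAlgCl 2)[X]).coeff j‖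
      ≤ 1 := by
  have hX : ‖((X : (PadicAlgCl 2)[X]) ^ 2).coeff j‖ ≤ 1 := by
    rw [coeff_X_pow]; split_ifs <;> simp
  have h1 : ‖(1 : (PadicAlgCl 2)[X]).coeff j‖ ≤ 1 := by
    rw [coeff_one]; split_ifs <;> simp
  have h2 : ‖(C (embCoeff g ι ℓ) * X : (PadicAlgCl 2)[X]).coeff j‖ ≤ 1 := by
    rw [coeff_C_mul, coeff_X, norm_mul]
    refine mul_le_one₀ (norm_embCoeff_le_one hg ι ℓ) (norm_nonneg _) ?_
    split_ifs <;> simp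
  have h3 : ‖((if ℓ ∣ M then 0 else C (ℓ : PadicAlgCl 2)) * X ^ 2 : (PadicAlgCl 2)[X]).coeff j‖ ≤ 1 := by
    split_ifs
    · rw [zero_mul, coeff_zero, norm_zero]; exact zero_le_one
    · rw [coeff_C_mul, norm_mul]
      exact mul_le_one₀ (Literature.NumberTheory.LFunctions.PadicRootsOfUnity.norm_natCast_le_one ℓ) (norm_nonneg _) hX
  rw [coeff_add, coeff_sub]
  refine (IsUltrametricDist.norm_add_le_max _ _).trans (max_le ?_ h3)
  rw [sub_eq_add_neg]
  exact (IsUltrametricDist.norm_add_le_max _ _).trans (max_le h1 (by rw [norm_neg]; exact h2))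

/-- **The partner's depleted plus-symbol values are integral at a cohomological period**:
`‖φ^{S₀}_{g,Ω}(γ^s/2^{n+2})‖ ≤ 1` (coefficients of the Euler polynomials integral, `‖ℓ_v⁻¹‖₂ = 1` for odd `ℓ_v`, all
`ι[r]⁺_{g,Ω}` integral — PW Def. 2.1). [cite: PollackWeston2011MT, Def. 2.1 and Rem. 2.2] -/
theorem norm_depletedPartnerSymbol_le_one {M : ℕ} [NeZero M] {g : CuspForm (CongruenceSubgroup.Gamma0 M) 2}
    (hg : IsNewform0 g) {ι : coeffField g →+* PadicAlgCl 2} {Ω : ℂ} (hΩ : IsCohomologicalPlusPeriod g ι Ω)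
    (S₀ : Finset (IsDedekindDomain.HeightOneSpectrum (NumberField.RingOfIntegers ℚ)))
    (hS2 : ∀ v ∈ S₀, ((2 : ℕ) : NumberField.RingOfIntegers ℚ) ∉ v.asIdeal) (n : ℕ) (s : ZMod (2 ^ n)) :
    ‖(∑ k ∈ Fintype.piFinset (fun _ : S₀ ↦ Finset.range 3), (∏ v : S₀, (1 - Polynomial.C (Literature.NumberTheory.EllipticCurves.embCoeff g ι (Rat.HeightOneSpectrum.natGenerator (v : IsDedekindDomain.HeightOneSpectrum (NumberField.RingOfIntegers ℚ)))) * Polynomial.X + (if Rat.HeightOneSpectrum.natGenerator (v : IsDedekindDomain.HeightOneSpectrum (NumberField.RingOfIntegers ℚ)) ∣ M then 0 else Polynomial.C (Rat.HeightOneSpectrum.natGenerator (v : IsDedekindDomain.HeightOneSpectrum (NumberField.RingOfIntegers ℚ)) : PadicAlgCl 2)) * Polynomial.X ^ 2 : Polynomial (PadicAlgCl 2)).coeff (k v) * ((Rat.HeightOneSpectrum.natGenerator (v : IsDedekindDomain.HeightOneSpectrum (NumberField.RingOfIntegers ℚ)) : PadicAlgCl 2)⁻¹) ^ (k v)) * ι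 (Literature.NumberTheory.EllipticCurves.plusSymbolK g Ω (((((Literature.NumberTheory.EllipticCurves.cyclotomicGenerator 2 : ZMod (2 ^ (n + 2))) ^ s.val).val : ℚ) / (2 : ℚ) ^ (n + 2)) * ((∏ v : S₀, Rat.HeightOneSpectrum.natGenerator (v : IsDedekindDomain.HeightOneSpectrum (NumberField.RingOfIntegers ℚ)) ^ (k v) : ℕ) : ℚ))))‖ ≤ 1 := by
  refine IsUltrametricDist.norm_sum_le_of_forall_le_of_nonneg zero_le_one fun k _ ↦ ?_
  rw [norm_mul, norm_prod]
  refine mul_le_one₀ (Finset.prod_le_one (fun v _ ↦ norm_nonneg _) fun v _ ↦ ?_) (norm_nonneg _)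
    (hΩ.norm_le_one _)
  rw [norm_mul, norm_pow, norm_inv, norm_natCast_padicAlgCl_two_eq_one (not_two_dvd_natGenerator (hS2 v v.2)),
    inv_one, one_pow, mul_one]
  exact norm_coeff_partnerEulerPolynomial_le_one hg ι _ _

/-- **(μ♮) at one layer ⟺ SOME layer-`n` depleted symbol value of the partner is a `2`-adic unit.** For a newform `g`,
a cohomological plus period `Ω` along `ι` and `S₀` off `2`: `‖Θ^{S₀}_n(g;Ω)‖_sup = ‖2‖₂` iff
`‖φ^{S₀}_{g,Ω}(γ^s/2^{n+2})‖ = 1` for some `s mod 2ⁿ` (exact depletion identity; all values are integral; isometry).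
[cite: PollackWeston2011MT, Def. 2.1 and §3.1] -/
theorem supNorm_eq_norm_two_iff_symbol {M : ℕ} [NeZero M]
    (g : CuspForm (CongruenceSubgroup.Gamma0 M) 2) (ι : coeffField g →+* PadicAlgCl 2) (Ω : ℂ)
    (S₀ : Finset (IsDedekindDomain.HeightOneSpectrum (NumberField.RingOfIntegers ℚ)))
    (hS2 : ∀ v ∈ S₀, ((2 : ℕ) : NumberField.RingOfIntegers ℚ) ∉ v.asIdeal) (n : ℕ)
    (hg : IsNewform0 g) (hΩ : IsCohomologicalPlusPeriod g ι Ω) :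
    (((Literature.NumberTheory.EllipticCurves.mazurTateElementK g Ω 2 n).map ι * ∏ v ∈ S₀, (1 - Polynomial.C (Literature.NumberTheory.EllipticCurves.embCoeff g ι (Rat.HeightOneSpectrum.natGenerator v)) * Polynomial.X + (if Rat.HeightOneSpectrum.natGenerator v ∣ M then 0 else Polynomial.C (Rat.HeightOneSpectrum.natGenerator v : PadicAlgCl 2)) * Polynomial.X ^ 2).comp (Polynomial.C ((Rat.HeightOneSpectrum.natGenerator v : PadicAlgCl 2)⁻¹) * (Polynomial.X + 1) ^ (PadicInt.toZModPow n (-(Literature.NumberTheory.EllipticCurves.GreenbergVatsal2000.frobeniusExponent 2 (Rat.HeightOneSpectrum.natGenerator v : ℤ_[2])))).val)) %ₘ ((Polynomial.X + 1) ^ 2 ^ n - 1)).supNorm = ‖(2 : PadicAlgCl 2)‖ ↔ ∃ s : ZMod (2 ^ n), ‖(∑ k ∈ Fintype.piFinset (fun _ : S₀ ↦ Finset.range 3), (∏ v : S₀, (1 - Polynomial.C (Literature.NumberTheory.EllipticCurves.embCoeff g ι (Rat.HeightOneSpectrum.natGenerator (v : IsDedekindDomain.HeightOneSpectrum (NumberField.RingOfIntegers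 ℚ)))) * Polynomial.X + (if Rat.HeightOneSpectrum.natGenerator (v : IsDedekindDomain.HeightOneSpectrum (NumberField.RingOfIntegers ℚ)) ∣ M then 0 else Polynomial.C (Rat.HeightOneSpectrum.natGenerator (v : IsDedekindDomain.HeightOneSpectrum (NumberField.RingOfIntegers ℚ)) : PadicAlgCl 2)) * Polynomial.X ^ 2 : Polynomial (PadicAlgCl 2)).coeff (k v) * ((Rat.HeightOneSpectrum.natGenerator (v : IsDedekindDomain.HeightOneSpectrum (NumberField.RingOfIntegers ℚ)) : PadicAlgCl 2)⁻¹) ^ (k v)) * ι (Literature.NumberTheory.EllipticCurves.plusSymbolK g Ω (((((Literature.NumberTheory.EllipticCurves.cyclotomicGenerator 2 : ZMod (2 ^ (n + 2))) ^ s.val).val : ℚ) / (2 : ℚ) ^ (n + 2)) * ((∏ v : S₀, Rat.HeightOneSpectrum.natGenerator (v : IsDedekindDomain.HeightOneSpectrum (NumberField.RingOfIntegers ℚ)) ^ (k v) : ℕ) : ℚ))))‖ = 1 := by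
  haveI : NeZero (2 ^ n) := ⟨pow_ne_zero _ two_ne_zero⟩
  rw [depletedPartnerLayer_eq_layerSum_depletedSymbol g Ω ι n M S₀ hS2, supNorm_C_mul, mul_right_eq_self₀,
    or_iff_left norm_two_padicAlgCl_pos.ne']
  exact supNorm_layerSum_eq_iff_of_forall_le _ (norm_depletedPartnerSymbol_le_one hg hΩ S₀ hS2 n)

end OneLayer

/-! ## §3. Package level: (H♮) ⟺ (H-sym), (μ♮) ⟺ (μ-sym), the minimal-`S₀` form, and the crux from skeleton v5 -/

section Package

/-- **(H♮) `stub_depletedLayerCongruenceTwo` of skeleton v4 ⟺ (H-sym)**: the integral congruence of the single-count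
depleted layer elements at level `‖2‖₂` is, layer by layer and with the same scalar `a`, the congruence modulo the
maximal ideal of ALL layer-`n` values of the depleted plus symbols: `‖a·φ^{S₀}_W(γ^s/2^{n+2}) − φ^{S₀}_{g,Ω}(γ^s/2^{n+2})‖ < 1`.
A lossless change of currency (no mathematics is added or lost). [cite: GreenbergVatsal2000, §1 (10)] -/
theorem stub_depletedLayerCongruenceTwo_iff_symbol :
    (∀ (W : WeierstrassCurve ℚ) [W.IsElliptic] [W.IsGloballyMinimal], ¬ W.HasCM → W.analyticRank = 0 → Literature.NumberTheory.EllipticCurves.Rank1Residual.GoodSS W 2 → W.frobeniusTrace 2 = 0 → W.Δ < 0 → ∀ (M : ℕ) [NeZero M] (g : CuspForm (CongruenceSubgroup.Gamma0 M) 2) (ι : Literature.NumberTheory.EllipticCurves.ModularForms.coeffField g →+* PadicAlgCl 2) (Ω : ℂ), Odd M → Literature.NumberTheory.EllipticCurves.ModularForms.IsNewform0 g → Literature.NumberTheory.Automorphic.IsCMForm (Literature.NumberTheory.EllipticCurves.ModularForms.liftToGamma1 M 2 g) → Literature.NumberTheory.EllipticCurves.ModularForms.cuspCoeff g 2 = 0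 → Literature.NumberTheory.EllipticCurves.IsCohomologicalPlusPeriod g ι Ω → (∀ ℓ : ℕ, ℓ.Prime → ¬ ℓ ∣ 2 * M * W.conductorNorm ℤ → ‖Literature.NumberTheory.EllipticCurves.embCoeff g ι ℓ - (W.frobeniusTrace ℓ : PadicAlgCl 2)‖ < 1) → ∀ [NeZero (W.conductorNorm ℤ)] (f : CuspForm (CongruenceSubgroup.Gamma0 (W.conductorNorm ℤ)) 2), Literature.NumberTheory.EllipticCurves.ModularForms.IsNewformOf W f → ∀ (S₀ : Finset (IsDedekindDomain.HeightOneSpectrum (NumberField.RingOfIntegers ℚ))), (∀ v ∈ S₀, ((2 : ℕ) : NumberField.RingOfIntegers ℚ) ∉ v.asIdeal) → (∀ v : IsDedekindDomain.HeightOneSpectrum (NumberField.RingOfIntegers ℚ), ¬ W.HasGoodReductionAt v → v ∈ S₀) → (∀ v : IsDedekindDomain.HeightOneSpectrum (NumberField.RingOfIntegers ℚ), Rat.HeightOneSpectrum.natGenerator v ∣ M → v ∈ S₀) → ∃ n₀ : ℕ, ∀ n ≥ n₀, Even n → ∃ a : PadicAlgCl 2, (Polynomial.C a * (((Literature.NumberTheory.EllipticCurves.mazurTateElement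 f 2 n).map (algebraMap ℚ (PadicAlgCl 2)) * ∏ v ∈ S₀, ((W.localPolynomialAt v).map (Int.castRingHom (PadicAlgCl 2))).comp (Polynomial.C ((Rat.HeightOneSpectrum.natGenerator v : PadicAlgCl 2)⁻¹) * (Polynomial.X + 1) ^ (PadicInt.toZModPow n (-(Literature.NumberTheory.EllipticCurves.GreenbergVatsal2000.frobeniusExponent 2 (Rat.HeightOneSpectrum.natGenerator v : ℤ_[2])))).val)) %ₘ ((Polynomial.X + 1) ^ 2 ^ n - 1)) - (((Literature.NumberTheory.EllipticCurves.mazurTateElementK g Ω 2 n).map ι * ∏ v ∈ S₀, (1 - Polynomial.C (Literature.NumberTheory.EllipticCurves.embCoeff g ι (Rat.HeightOneSpectrum.natGenerator v)) * Polynomial.X + (if Rat.HeightOneSpectrum.natGenerator v ∣ M then 0 else Polynomial.C (Rat.HeightOneSpectrum.natGenerator v : PadicAlgCl 2)) * Polynomial.X ^ 2).comp (Polynomial.C ((Rat.HeightOneSpectrum.natGenerator v : PadicAlgCl 2)⁻¹) * (Polynomial.X + 1) ^ (PadicInt.toZModPow n (-(Literature.NumberTheory.EllipticCurves.GreenbergVatsal2000.frobeniusExponent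 2 (Rat.HeightOneSpectrum.natGenerator v : ℤ_[2])))).val)) %ₘ ((Polynomial.X + 1) ^ 2 ^ n - 1))).supNorm < ‖(2 : PadicAlgCl 2)‖) ↔
      (∀ (W : WeierstrassCurve ℚ) [W.IsElliptic] [W.IsGloballyMinimal], ¬ W.HasCM → W.analyticRank = 0 → Literature.NumberTheory.EllipticCurves.Rank1Residual.GoodSS W 2 → W.frobeniusTrace 2 = 0 → W.Δ < 0 → ∀ (M : ℕ) [NeZero M] (g : CuspForm (CongruenceSubgroup.Gamma0 M) 2) (ι : Literature.NumberTheory.EllipticCurves.ModularForms.coeffField g →+* PadicAlgCl 2) (Ω : ℂ), Odd M → Literature.NumberTheory.EllipticCurves.ModularForms.IsNewform0 g → Literature.NumberTheory.Automorphic.IsCMForm (Literature.NumberTheory.EllipticCurves.ModularForms.liftToGamma1 M 2 g) → Literature.NumberTheory.EllipticCurves.ModularForms.cuspCoeff g 2 = 0 → Literature.NumberTheory.EllipticCurves.IsCohomologicalPlusPeriod g ι Ω → (∀ ℓ : ℕ, ℓ.Prime → ¬ ℓ ∣ 2 * M * W.conductorNorm ℤ → ‖Literature.NumberTheory.EllipticCurves.embCoeff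 g ι ℓ - (W.frobeniusTrace ℓ : PadicAlgCl 2)‖ < 1) → ∀ [NeZero (W.conductorNorm ℤ)] (f : CuspForm (CongruenceSubgroup.Gamma0 (W.conductorNorm ℤ)) 2), Literature.NumberTheory.EllipticCurves.ModularForms.IsNewformOf W f → ∀ (S₀ : Finset (IsDedekindDomain.HeightOneSpectrum (NumberField.RingOfIntegers ℚ))), (∀ v ∈ S₀, ((2 : ℕ) : NumberField.RingOfIntegers ℚ) ∉ v.asIdeal) → (∀ v : IsDedekindDomain.HeightOneSpectrum (NumberField.RingOfIntegers ℚ), ¬ W.HasGoodReductionAt v → v ∈ S₀) → (∀ v : IsDedekindDomain.HeightOneSpectrum (NumberField.RingOfIntegers ℚ), Rat.HeightOneSpectrum.natGenerator v ∣ M → v ∈ S₀) → ∃ n₀ : ℕ, ∀ n ≥ n₀, Even n → ∃ a : PadicAlgCl 2, ∀ s : ZMod (2 ^ n), ‖a * (∑ k ∈ Fintype.piFinset (fun _ : S₀ ↦ Finset.range 3), (∏ v : S₀, ((W.localPolynomialAt (v : IsDedekindDomain.HeightOneSpectrum (NumberField.RingOfIntegers ℚ))).map (Int.castRingHom (PadicAlgCl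 2))).coeff (k v) * ((Rat.HeightOneSpectrum.natGenerator (v : IsDedekindDomain.HeightOneSpectrum (NumberField.RingOfIntegers ℚ)) : PadicAlgCl 2)⁻¹) ^ (k v)) * algebraMap ℚ (PadicAlgCl 2) (Literature.NumberTheory.EllipticCurves.ratPlusSymbol f (((((Literature.NumberTheory.EllipticCurves.cyclotomicGenerator 2 : ZMod (2 ^ (n + 2))) ^ s.val).val : ℚ) / (2 : ℚ) ^ (n + 2)) * ((∏ v : S₀, Rat.HeightOneSpectrum.natGenerator (v : IsDedekindDomain.HeightOneSpectrum (NumberField.RingOfIntegers ℚ)) ^ (k v) : ℕ) : ℚ)))) - (∑ k ∈ Fintype.piFinset (fun _ : S₀ ↦ Finset.range 3), (∏ v : S₀, (1 - Polynomial.C (Literature.NumberTheory.EllipticCurves.embCoeff g ι (Rat.HeightOneSpectrum.natGenerator (v : IsDedekindDomain.HeightOneSpectrum (NumberField.RingOfIntegers ℚ)))) * Polynomial.X + (if Rat.HeightOneSpectrum.natGenerator (v : IsDedekindDomain.HeightOneSpectrum (NumberField.RingOfIntegers ℚ)) ∣ M then 0 else Polynomial.C (Rat.HeightOneSpectrum.natGenerator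 (v : IsDedekindDomain.HeightOneSpectrum (NumberField.RingOfIntegers ℚ)) : PadicAlgCl 2)) * Polynomial.X ^ 2 : Polynomial (PadicAlgCl 2)).coeff (k v) * ((Rat.HeightOneSpectrum.natGenerator (v : IsDedekindDomain.HeightOneSpectrum (NumberField.RingOfIntegers ℚ)) : PadicAlgCl 2)⁻¹) ^ (k v)) * ι (Literature.NumberTheory.EllipticCurves.plusSymbolK g Ω (((((Literature.NumberTheory.EllipticCurves.cyclotomicGenerator 2 : ZMod (2 ^ (n + 2))) ^ s.val).val : ℚ) / (2 : ℚ) ^ (n + 2)) * ((∏ v : S₀, Rat.HeightOneSpectrum.natGenerator (v : IsDedekindDomain.HeightOneSpectrum (NumberField.RingOfIntegers ℚ)) ^ (k v) : ℕ) : ℚ))))‖ < 1) := by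
  constructor
  · intro h W _ _ hcm hr hss ha hΔ M _ g ι Ω hodd hnew hcmg ha2 hΩ hcong _ f hf S₀ hS2 hSW hSM
    obtain ⟨n₀, hn₀⟩ := h W hcm hr hss ha hΔ M g ι Ω hodd hnew hcmg ha2 hΩ hcong f hf S₀ hS2 hSW hSM
    refine ⟨n₀, fun n hn he ↦ ?_⟩
    obtain ⟨a, ha'⟩ := hn₀ n hn he
    exact ⟨a, (supNorm_congr_lt_norm_two_iff_symbol W f g ι Ω S₀ hS2 n a).mp ha'⟩
  · intro h W _ _ hcm hr hss ha hΔ M _ g ι Ω hodd hnew hcmg ha2 hΩ hcong _ f hf S₀ hS2 hSW hSM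
    obtain ⟨n₀, hn₀⟩ := h W hcm hr hss ha hΔ M g ι Ω hodd hnew hcmg ha2 hΩ hcong f hf S₀ hS2 hSW hSM
    refine ⟨n₀, fun n hn he ↦ ?_⟩
    obtain ⟨a, ha'⟩ := hn₀ n hn he
    exact ⟨a, (supNorm_congr_lt_norm_two_iff_symbol W f g ι Ω S₀ hS2 n a).mpr ha'⟩

/-- **(μ♮) `stub_depletedLayerMuTwo` of skeleton v4 ⟺ (μ-sym)**: `μ = 0` of the partner's single-count depleted layer
element at a cohomological period is, layer by layer, the existence of ONE layer-`n` depleted plus-symbol value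
`φ^{S₀}_{g,Ω}(γ^s/2^{n+2})` of `2`-adic norm `1`. A lossless change of currency. [cite: PollackWeston2011MT, §3.1] -/
theorem stub_depletedLayerMuTwo_iff_symbol :
    (∀ (W : WeierstrassCurve ℚ) [W.IsElliptic] [W.IsGloballyMinimal], ¬ W.HasCM → W.analyticRank = 0 → Literature.NumberTheory.EllipticCurves.Rank1Residual.GoodSS W 2 → W.frobeniusTrace 2 = 0 → W.Δ < 0 → ∀ (M : ℕ) [NeZero M] (g : CuspForm (CongruenceSubgroup.Gamma0 M) 2) (ι : Literature.NumberTheory.EllipticCurves.ModularForms.coeffField g →+* PadicAlgCl 2) (Ω : ℂ), Odd M → Literature.NumberTheory.EllipticCurves.ModularForms.IsNewform0 g → Literature.NumberTheory.Automorphic.IsCMForm (Literature.NumberTheory.EllipticCurves.ModularForms.liftToGamma1 M 2 g) → Literature.NumberTheory.EllipticCurves.ModularForms.cuspCoeff g 2 = 0 → Literature.NumberTheory.EllipticCurves.IsCohomologicalPlusPeriod g ι Ω → (∀ ℓ : ℕ, ℓ.Prime → ¬ ℓ ∣ 2 * M * W.conductorNorm ℤ → ‖Literature.NumberTheory.EllipticCurves.embCoeff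 g ι ℓ - (W.frobeniusTrace ℓ : PadicAlgCl 2)‖ < 1) → ∀ [NeZero (W.conductorNorm ℤ)] (f : CuspForm (CongruenceSubgroup.Gamma0 (W.conductorNorm ℤ)) 2), Literature.NumberTheory.EllipticCurves.ModularForms.IsNewformOf W f → ∀ (S₀ : Finset (IsDedekindDomain.HeightOneSpectrum (NumberField.RingOfIntegers ℚ))), (∀ v ∈ S₀, ((2 : ℕ) : NumberField.RingOfIntegers ℚ) ∉ v.asIdeal) → (∀ v : IsDedekindDomain.HeightOneSpectrum (NumberField.RingOfIntegers ℚ), ¬ W.HasGoodReductionAt v → v ∈ S₀) → (∀ v : IsDedekindDomain.HeightOneSpectrum (NumberField.RingOfIntegers ℚ), Rat.HeightOneSpectrum.natGenerator v ∣ M → v ∈ S₀) → ∃ n₀ : ℕ, ∀ n ≥ n₀, Even n → (((Literature.NumberTheory.EllipticCurves.mazurTateElementK g Ω 2 n).map ι * ∏ v ∈ S₀, (1 - Polynomial.C (Literature.NumberTheory.EllipticCurves.embCoeff g ι (Rat.HeightOneSpectrum.natGenerator v)) * Polynomial.X + (if Rat.HeightOneSpectrum.natGenerator v ∣ M then 0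 else Polynomial.C (Rat.HeightOneSpectrum.natGenerator v : PadicAlgCl 2)) * Polynomial.X ^ 2).comp (Polynomial.C ((Rat.HeightOneSpectrum.natGenerator v : PadicAlgCl 2)⁻¹) * (Polynomial.X + 1) ^ (PadicInt.toZModPow n (-(Literature.NumberTheory.EllipticCurves.GreenbergVatsal2000.frobeniusExponent 2 (Rat.HeightOneSpectrum.natGenerator v : ℤ_[2])))).val)) %ₘ ((Polynomial.X + 1) ^ 2 ^ n - 1)).supNorm = ‖(2 : PadicAlgCl 2)‖) ↔
      (∀ (W : WeierstrassCurve ℚ) [W.IsElliptic] [W.IsGloballyMinimal], ¬ W.HasCM → W.analyticRank = 0 → Literature.NumberTheory.EllipticCurves.Rank1Residual.GoodSS W 2 → W.frobeniusTrace 2 = 0 → W.Δ < 0 → ∀ (M : ℕ) [NeZero M] (g : CuspForm (CongruenceSubgroup.Gamma0 M) 2) (ι : Literature.NumberTheory.EllipticCurves.ModularForms.coeffField g →+* PadicAlgCl 2) (Ω : ℂ), Odd M → Literature.NumberTheory.EllipticCurves.ModularForms.IsNewform0 g → Literature.NumberTheory.Automorphic.IsCMForm (Literature.NumberTheory.EllipticCurves.ModularForms.liftToGamma1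 M 2 g) → Literature.NumberTheory.EllipticCurves.ModularForms.cuspCoeff g 2 = 0 → Literature.NumberTheory.EllipticCurves.IsCohomologicalPlusPeriod g ι Ω → (∀ ℓ : ℕ, ℓ.Prime → ¬ ℓ ∣ 2 * M * W.conductorNorm ℤ → ‖Literature.NumberTheory.EllipticCurves.embCoeff g ι ℓ - (W.frobeniusTrace ℓ : PadicAlgCl 2)‖ < 1) → ∀ [NeZero (W.conductorNorm ℤ)] (f : CuspForm (CongruenceSubgroup.Gamma0 (W.conductorNorm ℤ)) 2), Literature.NumberTheory.EllipticCurves.ModularForms.IsNewformOf W f → ∀ (S₀ : Finset (IsDedekindDomain.HeightOneSpectrum (NumberField.RingOfIntegers ℚ))), (∀ v ∈ S₀, ((2 : ℕ) : NumberField.RingOfIntegers ℚ) ∉ v.asIdeal) → (∀ v : IsDedekindDomain.HeightOneSpectrum (NumberField.RingOfIntegers ℚ), ¬ W.HasGoodReductionAt v → v ∈ S₀) → (∀ v : IsDedekindDomain.HeightOneSpectrum (NumberField.RingOfIntegers ℚ), Rat.HeightOneSpectrum.natGenerator v ∣ M → v ∈ S₀) → ∃ n₀ : ℕ, ∀ n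 ≥ n₀, Even n → ∃ s : ZMod (2 ^ n), ‖(∑ k ∈ Fintype.piFinset (fun _ : S₀ ↦ Finset.range 3), (∏ v : S₀, (1 - Polynomial.C (Literature.NumberTheory.EllipticCurves.embCoeff g ι (Rat.HeightOneSpectrum.natGenerator (v : IsDedekindDomain.HeightOneSpectrum (NumberField.RingOfIntegers ℚ)))) * Polynomial.X + (if Rat.HeightOneSpectrum.natGenerator (v : IsDedekindDomain.HeightOneSpectrum (NumberField.RingOfIntegers ℚ)) ∣ M then 0 else Polynomial.C (Rat.HeightOneSpectrum.natGenerator (v : IsDedekindDomain.HeightOneSpectrum (NumberField.RingOfIntegers ℚ)) : PadicAlgCl 2)) * Polynomial.X ^ 2 : Polynomial (PadicAlgCl 2)).coeff (k v) * ((Rat.HeightOneSpectrum.natGenerator (v : IsDedekindDomain.HeightOneSpectrum (NumberField.RingOfIntegers ℚ)) : PadicAlgCl 2)⁻¹) ^ (k v)) * ι (Literature.NumberTheory.EllipticCurves.plusSymbolK g Ω (((((Literature.NumberTheory.EllipticCurves.cyclotomicGenerator 2 : ZMod (2 ^ (n + 2))) ^ s.val).val : ℚ) / (2 : ℚ) ^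 (n + 2)) * ((∏ v : S₀, Rat.HeightOneSpectrum.natGenerator (v : IsDedekindDomain.HeightOneSpectrum (NumberField.RingOfIntegers ℚ)) ^ (k v) : ℕ) : ℚ))))‖ = 1) := by
  constructor
  · intro h W _ _ hcm hr hss ha hΔ M _ g ι Ω hodd hnew hcmg ha2 hΩ hcong _ f hf S₀ hS2 hSW hSM
    obtain ⟨n₀, hn₀⟩ := h W hcm hr hss ha hΔ M g ι Ω hodd hnew hcmg ha2 hΩ hcong f hf S₀ hS2 hSW hSM
    exact ⟨n₀, fun n hn he ↦ (supNorm_eq_norm_two_iff_symbol g ι Ω S₀ hS2 n hnew hΩ).mp (hn₀ n hn he)⟩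
  · intro h W _ _ hcm hr hss ha hΔ M _ g ι Ω hodd hnew hcmg ha2 hΩ hcong _ f hf S₀ hS2 hSW hSM
    obtain ⟨n₀, hn₀⟩ := h W hcm hr hss ha hΔ M g ι Ω hodd hnew hcmg ha2 hΩ hcong f hf S₀ hS2 hSW hSM
    exact ⟨n₀, fun n hn he ↦ (supNorm_eq_norm_two_iff_symbol g ι Ω S₀ hS2 n hnew hΩ).mpr (hn₀ n hn he)⟩

/-- **(H-sym) on the MINIMAL admissible `S₀` gives (H♮) on the minimal admissible `S₀`** (the hypothesis of the landed
`S₀`-monotonicity `stub_depletedLayerCongruenceTwo_of_minimal`): pointwise translation as in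
`stub_depletedLayerCongruenceTwo_iff_symbol`, the minimality clause `∀ v ∈ S₀, v bad ∨ ℓ_v ∣ M` riding along.
[cite: GreenbergVatsal2000, §1 (10)] -/
theorem stub_depletedLayerCongruenceTwoMinimal_of_symbol
    (h : ∀ (W : WeierstrassCurve ℚ) [W.IsElliptic] [W.IsGloballyMinimal], ¬ W.HasCM → W.analyticRank = 0 → Literature.NumberTheory.EllipticCurves.Rank1Residual.GoodSS W 2 → W.frobeniusTrace 2 = 0 → W.Δ < 0 → ∀ (M : ℕ) [NeZero M] (g : CuspForm (CongruenceSubgroup.Gamma0 M) 2) (ι : Literature.NumberTheory.EllipticCurves.ModularForms.coeffField g →+* PadicAlgCl 2) (Ω : ℂ), Odd M → Literature.NumberTheory.EllipticCurves.ModularForms.IsNewform0 g → Literature.NumberTheory.Automorphic.IsCMForm (Literature.NumberTheory.EllipticCurves.ModularForms.liftToGamma1 M 2 g) → Literature.NumberTheory.EllipticCurves.ModularForms.cuspCoeff g 2 = 0 → Literature.NumberTheory.EllipticCurves.IsCohomologicalPlusPeriod g ι Ω → (∀ ℓ : ℕ, ℓ.Prime → ¬ ℓ ∣ 2 * M * W.conductorNorm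 ℤ → ‖Literature.NumberTheory.EllipticCurves.embCoeff g ι ℓ - (W.frobeniusTrace ℓ : PadicAlgCl 2)‖ < 1) → ∀ [NeZero (W.conductorNorm ℤ)] (f : CuspForm (CongruenceSubgroup.Gamma0 (W.conductorNorm ℤ)) 2), Literature.NumberTheory.EllipticCurves.ModularForms.IsNewformOf W f → ∀ (S₀ : Finset (IsDedekindDomain.HeightOneSpectrum (NumberField.RingOfIntegers ℚ))), (∀ v ∈ S₀, ((2 : ℕ) : NumberField.RingOfIntegers ℚ) ∉ v.asIdeal) → (∀ v : IsDedekindDomain.HeightOneSpectrum (NumberField.RingOfIntegers ℚ), ¬ W.HasGoodReductionAt v → v ∈ S₀) → (∀ v : IsDedekindDomain.HeightOneSpectrum (NumberField.RingOfIntegers ℚ), Rat.HeightOneSpectrum.natGenerator v ∣ M → v ∈ S₀) → (∀ v ∈ S₀, ¬ W.HasGoodReductionAt v ∨ Rat.HeightOneSpectrum.natGenerator v ∣ M) → ∃ n₀ : ℕ, ∀ n ≥ n₀, Even n → ∃ a : PadicAlgCl 2, ∀ s : ZMod (2 ^ n), ‖a * (∑ k ∈ Fintype.piFinset (fun _ :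 S₀ ↦ Finset.range 3), (∏ v : S₀, ((W.localPolynomialAt (v : IsDedekindDomain.HeightOneSpectrum (NumberField.RingOfIntegers ℚ))).map (Int.castRingHom (PadicAlgCl 2))).coeff (k v) * ((Rat.HeightOneSpectrum.natGenerator (v : IsDedekindDomain.HeightOneSpectrum (NumberField.RingOfIntegers ℚ)) : PadicAlgCl 2)⁻¹) ^ (k v)) * algebraMap ℚ (PadicAlgCl 2) (Literature.NumberTheory.EllipticCurves.ratPlusSymbol f (((((Literature.NumberTheory.EllipticCurves.cyclotomicGenerator 2 : ZMod (2 ^ (n + 2))) ^ s.val).val : ℚ) / (2 : ℚ) ^ (n + 2)) * ((∏ v : S₀, Rat.HeightOneSpectrum.natGenerator (v : IsDedekindDomain.HeightOneSpectrum (NumberField.RingOfIntegers ℚ)) ^ (k v) : ℕ) : ℚ)))) - (∑ k ∈ Fintype.piFinset (fun _ : S₀ ↦ Finset.range 3), (∏ v : S₀, (1 - Polynomial.C (Literature.NumberTheory.EllipticCurves.embCoeff g ι (Rat.HeightOneSpectrum.natGenerator (v : IsDedekindDomain.HeightOneSpectrum (NumberField.RingOfIntegers ℚ)))) * Polynomial.X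 + (if Rat.HeightOneSpectrum.natGenerator (v : IsDedekindDomain.HeightOneSpectrum (NumberField.RingOfIntegers ℚ)) ∣ M then 0 else Polynomial.C (Rat.HeightOneSpectrum.natGenerator (v : IsDedekindDomain.HeightOneSpectrum (NumberField.RingOfIntegers ℚ)) : PadicAlgCl 2)) * Polynomial.X ^ 2 : Polynomial (PadicAlgCl 2)).coeff (k v) * ((Rat.HeightOneSpectrum.natGenerator (v : IsDedekindDomain.HeightOneSpectrum (NumberField.RingOfIntegers ℚ)) : PadicAlgCl 2)⁻¹) ^ (k v)) * ι (Literature.NumberTheory.EllipticCurves.plusSymbolK g Ω (((((Literature.NumberTheory.EllipticCurves.cyclotomicGenerator 2 : ZMod (2 ^ (n + 2))) ^ s.val).val : ℚ) / (2 : ℚ) ^ (n + 2)) * ((∏ v : S₀, Rat.HeightOneSpectrum.natGenerator (v : IsDedekindDomain.HeightOneSpectrum (NumberField.RingOfIntegers ℚ)) ^ (k v) : ℕ) : ℚ))))‖ < 1) :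
    ∀ (W : WeierstrassCurve ℚ) [W.IsElliptic] [W.IsGloballyMinimal], ¬ W.HasCM → W.analyticRank = 0 → Literature.NumberTheory.EllipticCurves.Rank1Residual.GoodSS W 2 → W.frobeniusTrace 2 = 0 → W.Δ < 0 → ∀ (M : ℕ) [NeZero M] (g : CuspForm (CongruenceSubgroup.Gamma0 M) 2) (ι : Literature.NumberTheory.EllipticCurves.ModularForms.coeffField g →+* PadicAlgCl 2) (Ω : ℂ), Odd M → Literature.NumberTheory.EllipticCurves.ModularForms.IsNewform0 g → Literature.NumberTheory.Automorphic.IsCMForm (Literature.NumberTheory.EllipticCurves.ModularForms.liftToGamma1 M 2 g) → Literature.NumberTheory.EllipticCurves.ModularForms.cuspCoeff g 2 = 0 → Literature.NumberTheory.EllipticCurves.IsCohomologicalPlusPeriod g ι Ω → (∀ ℓ : ℕ, ℓ.Prime → ¬ ℓ ∣ 2 * M * W.conductorNorm ℤ → ‖Literature.NumberTheory.EllipticCurves.embCoeff g ι ℓ - (W.frobeniusTrace ℓ : PadicAlgCl 2)‖ < 1) → ∀ [NeZero (W.conductorNorm ℤ)] (f : CuspForm (CongruenceSubgroup.Gamma0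 (W.conductorNorm ℤ)) 2), Literature.NumberTheory.EllipticCurves.ModularForms.IsNewformOf W f → ∀ (S₀ : Finset (IsDedekindDomain.HeightOneSpectrum (NumberField.RingOfIntegers ℚ))), (∀ v ∈ S₀, ((2 : ℕ) : NumberField.RingOfIntegers ℚ) ∉ v.asIdeal) → (∀ v : IsDedekindDomain.HeightOneSpectrum (NumberField.RingOfIntegers ℚ), ¬ W.HasGoodReductionAt v → v ∈ S₀) → (∀ v : IsDedekindDomain.HeightOneSpectrum (NumberField.RingOfIntegers ℚ), Rat.HeightOneSpectrum.natGenerator v ∣ M → v ∈ S₀) → (∀ v ∈ S₀, ¬ W.HasGoodReductionAt v ∨ Rat.HeightOneSpectrum.natGenerator v ∣ M) → ∃ n₀ : ℕ, ∀ n ≥ n₀, Even n → ∃ a : PadicAlgCl 2, (Polynomial.C a * (((Literature.NumberTheory.EllipticCurves.mazurTateElement f 2 n).map (algebraMap ℚ (PadicAlgCl 2)) * ∏ v ∈ S₀, ((W.localPolynomialAt v).map (Int.castRingHom (PadicAlgCl 2))).comp (Polynomial.C ((Rat.HeightOneSpectrum.natGenerator v : PadicAlgCl 2)⁻¹) * (Polynomial.X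 + 1) ^ (PadicInt.toZModPow n (-(Literature.NumberTheory.EllipticCurves.GreenbergVatsal2000.frobeniusExponent 2 (Rat.HeightOneSpectrum.natGenerator v : ℤ_[2])))).val)) %ₘ ((Polynomial.X + 1) ^ 2 ^ n - 1)) - (((Literature.NumberTheory.EllipticCurves.mazurTateElementK g Ω 2 n).map ι * ∏ v ∈ S₀, (1 - Polynomial.C (Literature.NumberTheory.EllipticCurves.embCoeff g ι (Rat.HeightOneSpectrum.natGenerator v)) * Polynomial.X + (if Rat.HeightOneSpectrum.natGenerator v ∣ M then 0 else Polynomial.C (Rat.HeightOneSpectrum.natGenerator v : PadicAlgCl 2)) * Polynomial.X ^ 2).comp (Polynomial.C ((Rat.HeightOneSpectrum.natGenerator v : PadicAlgCl 2)⁻¹) * (Polynomial.X + 1) ^ (PadicInt.toZModPow n (-(Literature.NumberTheory.EllipticCurves.GreenbergVatsal2000.frobeniusExponent 2 (Rat.HeightOneSpectrum.natGenerator v : ℤ_[2])))).val)) %ₘ ((Polynomial.X + 1) ^ 2 ^ n - 1))).supNorm < ‖(2 : PadicAlgCl 2)‖ := by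
  intro W _ _ hcm hr hss ha hΔ M _ g ι Ω hodd hnew hcmg ha2 hΩ hcong _ f hf S₀ hS2 hSW hSM hmin
  obtain ⟨n₀, hn₀⟩ := h W hcm hr hss ha hΔ M g ι Ω hodd hnew hcmg ha2 hΩ hcong f hf S₀ hS2 hSW hSM hmin
  refine ⟨n₀, fun n hn he ↦ ?_⟩
  obtain ⟨a, ha'⟩ := hn₀ n hn he
  exact ⟨a, (supNorm_congr_lt_norm_two_iff_symbol W f g ι Ω S₀ hS2 n a).mpr ha'⟩

/-- **THE CRUX `ThetaLayerLambdaCongruenceAtTwo` BY NAME from the two SYMBOL-LEVEL stubs of skeleton v5 of line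
`birth`** — (H-sym-min) `stub_depletedSymbolCongruenceTwo`: on the habitat⁺, for every partner datum with a
COHOMOLOGICAL plus period, the newform `f` of `W` and every MINIMAL admissible `S₀` (odd places, all bad for `W` or
dividing `M`, containing bad(W) ∪ primes(M)), for all large even `n` some `a ∈ ℚ̄₂` makes ALL layer-`n` depleted
plus-symbol values congruent, `‖a·φ^{S₀}_W(γ^s/2^{n+2}) − φ^{S₀}_{g,Ω}(γ^s/2^{n+2})‖ < 1` (Greenberg–Vatsal (10) READ AT
`2`; research: mod-`2` multiplicity one on the plus part + Ihara at `2`); and (μ-sym) `stub_depletedSymbolUnitTwo`: for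
all large even `n` SOME layer-`n` value `φ^{S₀}_{g,Ω}(γ^s/2^{n+2})` is a `2`-adic unit (`μ = 0` of the partner's depleted
symbol; conjecture-grade). PROOF: (H-sym-min) ⟹ (H♮-min) ⟹ (H♮) (`S₀`-monotonicity, landed) and (μ-sym) ⟹ (μ♮); then
the landed glue `thetaLayerLambdaCongruenceAtTwo_of_cohStubs_two` ((coh) = item 22892, A2 inside).
[cite: GreenbergVatsal2000, §1 (10) and Thm. (1.4) (shape; the two inputs are hypotheses)] -/
theorem thetaLayerLambdaCongruenceAtTwo_of_symbolStubs
    (hH : ∀ (W : WeierstrassCurve ℚ) [W.IsElliptic] [W.IsGloballyMinimal], ¬ W.HasCM → W.analyticRank = 0 → Literature.NumberTheory.EllipticCurves.Rank1Residual.GoodSS W 2 → W.frobeniusTrace 2 = 0 → W.Δ < 0 → ∀ (M : ℕ) [NeZero M] (g : CuspForm (CongruenceSubgroup.Gamma0 M) 2) (ι : Literature.NumberTheory.EllipticCurves.ModularForms.coeffField g →+* PadicAlgCl 2) (Ω : ℂ), Odd M → Literature.NumberTheory.EllipticCurves.ModularForms.IsNewform0 g → Literature.NumberTheory.Automorphic.IsCMForm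 (Literature.NumberTheory.EllipticCurves.ModularForms.liftToGamma1 M 2 g) → Literature.NumberTheory.EllipticCurves.ModularForms.cuspCoeff g 2 = 0 → Literature.NumberTheory.EllipticCurves.IsCohomologicalPlusPeriod g ι Ω → (∀ ℓ : ℕ, ℓ.Prime → ¬ ℓ ∣ 2 * M * W.conductorNorm ℤ → ‖Literature.NumberTheory.EllipticCurves.embCoeff g ι ℓ - (W.frobeniusTrace ℓ : PadicAlgCl 2)‖ < 1) → ∀ [NeZero (W.conductorNorm ℤ)] (f : CuspForm (CongruenceSubgroup.Gamma0 (W.conductorNorm ℤ)) 2), Literature.NumberTheory.EllipticCurves.ModularForms.IsNewformOf W f → ∀ (S₀ : Finset (IsDedekindDomain.HeightOneSpectrum (NumberField.RingOfIntegers ℚ))), (∀ v ∈ S₀, ((2 : ℕ) : NumberField.RingOfIntegers ℚ) ∉ v.asIdeal) → (∀ v : IsDedekindDomain.HeightOneSpectrum (NumberField.RingOfIntegers ℚ), ¬ W.HasGoodReductionAt v → v ∈ S₀) → (∀ v : IsDedekindDomain.HeightOneSpectrum (NumberField.RingOfIntegers ℚ), Rat.HeightOneSpectrum.natGenerator v ∣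 M → v ∈ S₀) → (∀ v ∈ S₀, ¬ W.HasGoodReductionAt v ∨ Rat.HeightOneSpectrum.natGenerator v ∣ M) → ∃ n₀ : ℕ, ∀ n ≥ n₀, Even n → ∃ a : PadicAlgCl 2, ∀ s : ZMod (2 ^ n), ‖a * (∑ k ∈ Fintype.piFinset (fun _ : S₀ ↦ Finset.range 3), (∏ v : S₀, ((W.localPolynomialAt (v : IsDedekindDomain.HeightOneSpectrum (NumberField.RingOfIntegers ℚ))).map (Int.castRingHom (PadicAlgCl 2))).coeff (k v) * ((Rat.HeightOneSpectrum.natGenerator (v : IsDedekindDomain.HeightOneSpectrum (NumberField.RingOfIntegers ℚ)) : PadicAlgCl 2)⁻¹) ^ (k v)) * algebraMap ℚ (PadicAlgCl 2) (Literature.NumberTheory.EllipticCurves.ratPlusSymbol f (((((Literature.NumberTheory.EllipticCurves.cyclotomicGenerator 2 : ZMod (2 ^ (n + 2))) ^ s.val).val : ℚ) / (2 : ℚ) ^ (n + 2)) * ((∏ v : S₀, Rat.HeightOneSpectrum.natGenerator (v : IsDedekindDomain.HeightOneSpectrum (NumberField.RingOfIntegers ℚ)) ^ (k v) : ℕ)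 : ℚ)))) - (∑ k ∈ Fintype.piFinset (fun _ : S₀ ↦ Finset.range 3), (∏ v : S₀, (1 - Polynomial.C (Literature.NumberTheory.EllipticCurves.embCoeff g ι (Rat.HeightOneSpectrum.natGenerator (v : IsDedekindDomain.HeightOneSpectrum (NumberField.RingOfIntegers ℚ)))) * Polynomial.X + (if Rat.HeightOneSpectrum.natGenerator (v : IsDedekindDomain.HeightOneSpectrum (NumberField.RingOfIntegers ℚ)) ∣ M then 0 else Polynomial.C (Rat.HeightOneSpectrum.natGenerator (v : IsDedekindDomain.HeightOneSpectrum (NumberField.RingOfIntegers ℚ)) : PadicAlgCl 2)) * Polynomial.X ^ 2 : Polynomial (PadicAlgCl 2)).coeff (k v) * ((Rat.HeightOneSpectrum.natGenerator (v : IsDedekindDomain.HeightOneSpectrum (NumberField.RingOfIntegers ℚ)) : PadicAlgCl 2)⁻¹) ^ (k v)) * ι (Literature.NumberTheory.EllipticCurves.plusSymbolK g Ω (((((Literature.NumberTheory.EllipticCurves.cyclotomicGenerator 2 : ZMod (2 ^ (n + 2))) ^ s.val).val : ℚ) / (2 : ℚ) ^ (n + 2)) * ((∏ v : S₀, Rat.HeightOneSpectrum.natGenerator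 (v : IsDedekindDomain.HeightOneSpectrum (NumberField.RingOfIntegers ℚ)) ^ (k v) : ℕ) : ℚ))))‖ < 1)
    (hμ : ∀ (W : WeierstrassCurve ℚ) [W.IsElliptic] [W.IsGloballyMinimal], ¬ W.HasCM → W.analyticRank = 0 → Literature.NumberTheory.EllipticCurves.Rank1Residual.GoodSS W 2 → W.frobeniusTrace 2 = 0 → W.Δ < 0 → ∀ (M : ℕ) [NeZero M] (g : CuspForm (CongruenceSubgroup.Gamma0 M) 2) (ι : Literature.NumberTheory.EllipticCurves.ModularForms.coeffField g →+* PadicAlgCl 2) (Ω : ℂ), Odd M → Literature.NumberTheory.EllipticCurves.ModularForms.IsNewform0 g → Literature.NumberTheory.Automorphic.IsCMForm (Literature.NumberTheory.EllipticCurves.ModularForms.liftToGamma1 M 2 g) → Literature.NumberTheory.EllipticCurves.ModularForms.cuspCoeff g 2 = 0 → Literature.NumberTheory.EllipticCurves.IsCohomologicalPlusPeriod g ι Ω → (∀ ℓ : ℕ, ℓ.Prime → ¬ ℓ ∣ 2 * M * W.conductorNorm ℤ → ‖Literature.NumberTheory.EllipticCurves.embCoeff g ι ℓ - (W.frobeniusTrace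 ℓ : PadicAlgCl 2)‖ < 1) → ∀ [NeZero (W.conductorNorm ℤ)] (f : CuspForm (CongruenceSubgroup.Gamma0 (W.conductorNorm ℤ)) 2), Literature.NumberTheory.EllipticCurves.ModularForms.IsNewformOf W f → ∀ (S₀ : Finset (IsDedekindDomain.HeightOneSpectrum (NumberField.RingOfIntegers ℚ))), (∀ v ∈ S₀, ((2 : ℕ) : NumberField.RingOfIntegers ℚ) ∉ v.asIdeal) → (∀ v : IsDedekindDomain.HeightOneSpectrum (NumberField.RingOfIntegers ℚ), ¬ W.HasGoodReductionAt v → v ∈ S₀) → (∀ v : IsDedekindDomain.HeightOneSpectrum (NumberField.RingOfIntegers ℚ), Rat.HeightOneSpectrum.natGenerator v ∣ M → v ∈ S₀) → ∃ n₀ : ℕ, ∀ n ≥ n₀, Even n → ∃ s : ZMod (2 ^ n), ‖(∑ k ∈ Fintype.piFinset (fun _ : S₀ ↦ Finset.range 3), (∏ v : S₀, (1 - Polynomial.C (Literature.NumberTheory.EllipticCurves.embCoeff g ι (Rat.HeightOneSpectrum.natGenerator (v : IsDedekindDomain.HeightOneSpectrum (NumberField.RingOfIntegers ℚ)))) * Polynomial.X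 + (if Rat.HeightOneSpectrum.natGenerator (v : IsDedekindDomain.HeightOneSpectrum (NumberField.RingOfIntegers ℚ)) ∣ M then 0 else Polynomial.C (Rat.HeightOneSpectrum.natGenerator (v : IsDedekindDomain.HeightOneSpectrum (NumberField.RingOfIntegers ℚ)) : PadicAlgCl 2)) * Polynomial.X ^ 2 : Polynomial (PadicAlgCl 2)).coeff (k v) * ((Rat.HeightOneSpectrum.natGenerator (v : IsDedekindDomain.HeightOneSpectrum (NumberField.RingOfIntegers ℚ)) : PadicAlgCl 2)⁻¹) ^ (k v)) * ι (Literature.NumberTheory.EllipticCurves.plusSymbolK g Ω (((((Literature.NumberTheory.EllipticCurves.cyclotomicGenerator 2 : ZMod (2 ^ (n + 2))) ^ s.val).val : ℚ) / (2 : ℚ) ^ (n + 2)) * ((∏ v : S₀, Rat.HeightOneSpectrum.natGenerator (v : IsDedekindDomain.HeightOneSpectrum (NumberField.RingOfIntegers ℚ)) ^ (k v) : ℕ) : ℚ))))‖ = 1) :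
    Summit.BirchSwinnertonDyer.BirchSwinnertonDyer.Theses.ResidualThetaTransportAtTwo.ThetaLayerLambdaCongruenceAtTwo :=
  thetaLayerLambdaCongruenceAtTwo_of_cohStubs_two
    (stub_depletedLayerCongruenceTwo_of_minimal (stub_depletedLayerCongruenceTwoMinimal_of_symbol hH))
    (stub_depletedLayerMuTwo_iff_symbol.mpr hμ)

end Package

end Summit.BirchSwinnertonDyer.BirchSwinnertonDyer.Theorems.ThetaLayerLambdaCongruenceAtTwo

end
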